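import Literature.Computability.QuantumComplexity.HidingGoodEvent
import Literature.Computability.QuantumComplexity.HidingProgramMachine
import HarnessLib

/-!
# The proof of AA13 Thm. 1.3: the parameters of the machine (integer bookkeeping)

Family `quantum-advantage`. The concrete polynomials of the `FBPP^{NP^𝒪}` machine of the discharge
of Aaronson–Arkhipov's Thm. 1.3 and the integer inequalities between them:

* `hidH` — the six polynomials of `HPolys` (modes `m = 2^{size(2⁵⁵(N+1)¹⁵)}`, sampler granularity
  `2^k > 16384 N²(N+1)²`, attempts `J = 128(N+1)(2N+4)`, `kβ = 4096N²`, `kη = 512N²`, `kδS = 16N`);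
  `precP = 16(N+1)²` — the input precision `b`; `coinP p₀ c_𝒪 c_S` — the coin polynomial, an
  explicit polynomial upper bound for the three coin fields (positions, sampler array, counter,
  the last through `stockLenB`, `queryLenPoly`);
* the bookkeeping: `m` versus `mP` (`hidH_m_bounds`), `3n² ≤ m`, the range exponent
  (`two_pow_r₀_bounds`), `2^k` versus `kP`, the size of `2ᵇ` (`two_pow_precP_ge`), and the coin
  budget `coinP N = n μ + m·n·2L_c + LU` with `stockLenB ≤ LU`, `N ≤ coinP N`, `b ≤ coinP N`
  (`coin_fields`).

All proved, no new named facts.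

## References

* S. Aaronson, A. Arkhipov, *The computational complexity of linear optics*, Theory of Computing 9
  (2013) 143–252, proof of Thm. 1.3, §5.2 (pp. 192–195) ("all parameters polynomial in `n`,
  `1/ε`, `1/δ`").
-/

noncomputable section

namespace Literature.Computability.QuantumComplexity

open Polynomial Literature.Computability.Complexity Literature.Probability.Distributions

/-! ### The polynomials -/

/-- **The six polynomials of the machine.** [cite: AaronsonArkhipovToC2013, proof of Thm. 1.3 (p. 195)] -/
def hidH : HPolys where
  mP := 2 ^ 55 * (X + 1) ^ 15
  kP := 16384 * X ^ 2 * (X + 1) ^ 2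
  JP := 128 * (X + 1) * (2 * X + 4)
  kβP := 4096 * X ^ 2
  kηP := 512 * X ^ 2
  kδSP := 16 * X

/-- **The input precision** `b = 16(N+1)²`. [cite: AaronsonArkhipovToC2013, §2 (p. 161)] -/
def precP : Polynomial ℕ := 16 * (X + 1) ^ 2

/-- Evaluations of the polynomials. [folklore] -/
@[simp] theorem hidH_mP_eval (N : ℕ) : hidH.mP.eval N = 2 ^ 55 * (N + 1) ^ 15 := by simp [hidH]

/-- Evaluations of the polynomials. [folklore] -/
@[simp] theorem hidH_kP_eval (N : ℕ) : hidH.kP.eval N = 16384 * N ^ 2 * (N + 1) ^ 2 := by simp [hidH]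

/-- Evaluations of the polynomials. [folklore] -/
@[simp] theorem hidH_J (N : ℕ) : hidH.J N = 128 * (N + 1) * (2 * N + 4) := by simp [hidH, HPolys.J]

/-- Evaluations of the polynomials. [folklore] -/
@[simp] theorem hidH_kβ (N : ℕ) : hidH.kβ N = 4096 * N ^ 2 := by simp [hidH, HPolys.kβ]

/-- Evaluations of the polynomials. [folklore] -/
@[simp] theorem hidH_kη (N : ℕ) : hidH.kη N = 512 * N ^ 2 := by simp [hidH, HPolys.kη]

/-- Evaluations of the polynomials. [folklore] -/
@[simp] theorem hidH_kδS (N : ℕ) : hidH.kδS N = 16 * N := by simp [hidH, HPolys.kδS]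

/-- Evaluation of the precision. [folklore] -/
@[simp] theorem precP_eval (N : ℕ) : precP.eval N = 16 * (N + 1) ^ 2 := by simp [precP]

/-! ### The number of modes -/

/-- **`mP(N) < m ≤ 2 mP(N) + 1`** (`m = 2^{size mP(N)}`). [folklore] -/
theorem hidH_m_bounds (N : ℕ) : 2 ^ 55 * (N + 1) ^ 15 < hidH.m N ∧ hidH.m N ≤ 2 * (2 ^ 55 * (N + 1) ^ 15) + 1 := by
  constructor
  · have := hidH.lt_m N
    rwa [hidH_mP_eval] at this
  · unfold HPolys.m HPolys.μ
    rw [hidH_mP_eval]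
    have hpos : 0 < 2 ^ 55 * (N + 1) ^ 15 := by positivity
    exact (two_pow_size_le' hpos).trans (Nat.le_succ _)

/-- `N ≤ m`, `3N² ≤ m`, `16 N³ ≤ m` (very crude). [folklore] -/
theorem le_hidH_m (N : ℕ) : N ≤ hidH.m N ∧ 3 * N ^ 2 ≤ hidH.m N ∧ 16 * N ^ 3 ≤ hidH.m N := by
  have h := (hidH_m_bounds N).1
  have h1 : N ≤ (N + 1) ^ 15 := by
    calc N ≤ N + 1 := Nat.le_succ _
      _ = (N + 1) ^ 1 := (pow_one _).symm
      _ ≤ (N + 1) ^ 15 := Nat.pow_le_pow_right (Nat.succ_pos _) (by norm_num)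
  have h2 : N ^ 2 ≤ (N + 1) ^ 15 := by
    calc N ^ 2 ≤ (N + 1) ^ 2 := Nat.pow_le_pow_left (Nat.le_succ _) _
      _ ≤ (N + 1) ^ 15 := Nat.pow_le_pow_right (Nat.succ_pos _) (by norm_num)
  have h3 : N ^ 3 ≤ (N + 1) ^ 15 := by
    calc N ^ 3 ≤ (N + 1) ^ 3 := Nat.pow_le_pow_left (Nat.le_succ _) _
      _ ≤ (N + 1) ^ 15 := Nat.pow_le_pow_right (Nat.succ_pos _) (by norm_num)
  have h55 : (16 : ℕ) ≤ 2 ^ 55 := by norm_num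
  refine ⟨?_, ?_, ?_⟩ <;> nlinarith

/-! ### The sampler's exponents -/

/-- **The range exponent**: `8(size N + 1) < 2^{r₀} ≤ 16(size N + 1)` and `r₀ ≥ 3`. [folklore] -/
theorem two_pow_r₀_bounds (N : ℕ) :
    8 * (Nat.size N + 1) < 2 ^ HPolys.r₀ N ∧ 2 ^ HPolys.r₀ N ≤ 16 * (Nat.size N + 1) ∧ 3 ≤ HPolys.r₀ N := by
  unfold HPolys.r₀
  refine ⟨?_, ?_, by omega⟩
  · rw [pow_add]
    have := Nat.lt_size_self (Nat.size N + 1)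
    omega
  · rw [pow_add]
    have := two_pow_size_le' (x := Nat.size N + 1) (by omega)
    omega

/-- `2^{8 size N} > N⁸` (for the Gaussian tails in `R ≥ 8(size N + 1)`). [folklore] -/
theorem pow_eight_lt_two_pow_size (N : ℕ) : N ^ 8 < 2 ^ (8 * Nat.size N) := by
  rw [pow_mul']
  exact Nat.pow_lt_pow_left (Nat.lt_size_self N) (by norm_num)

/-- **The granularity exponent**: `kP(N) < 2^k ≤ 2 kP(N) + 1`, and `1 ≤ k` once `N ≥ 1`. [folklore] -/
theorem two_pow_k_bounds (N : ℕ) :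
    16384 * N ^ 2 * (N + 1) ^ 2 < 2 ^ hidH.k N ∧ 2 ^ hidH.k N ≤ 2 * (16384 * N ^ 2 * (N + 1) ^ 2) + 1 ∧ (1 ≤ N → 1 ≤ hidH.k N) := by
  unfold HPolys.k
  rw [hidH_kP_eval]
  refine ⟨Nat.lt_size_self _, ?_, fun hN => ?_⟩
  · rcases Nat.eq_zero_or_pos (16384 * N ^ 2 * (N + 1) ^ 2) with h | h
    · rw [h]; simp
    · exact (two_pow_size_le' h).trans (Nat.le_succ _)
  · exact Nat.size_pos.2 (by positivity)

/-! ### The precision -/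

/-- `2^{precP N} ≥ 2^{3N² + 6N + 10}` (room for `2ᵇ ≥ 512N²(N+1)` and `2ᵇ ≥ 4N²9ᴺN^{3N}`). [folklore] -/
theorem le_precP (N : ℕ) : 3 * N ^ 2 + 6 * N + 10 ≤ precP.eval N ∧ 1 ≤ precP.eval N := by
  rw [precP_eval]
  have : 1 ≤ (N + 1) ^ 2 := Nat.one_le_pow _ _ (Nat.succ_pos _)
  constructor <;> nlinarith

/-- **`2ᵇ ≥ 512 N²(N+1)`** (the mesh against the range: `hR ≤ 1/(32n²)`). [folklore] -/
theorem two_pow_precP_ge (N : ℕ) : 512 * N ^ 2 * (N + 1) ≤ 2 ^ precP.eval N := by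
  have h1 : N ≤ 2 ^ N := Nat.lt_two_pow_self.le
  have h2 : N + 1 ≤ 2 ^ (N + 1) := Nat.lt_two_pow_self.le
  calc 512 * N ^ 2 * (N + 1) ≤ 2 ^ 9 * (2 ^ N) ^ 2 * 2 ^ (N + 1) := by
        have := Nat.pow_le_pow_left h1 2
        have h512 : (512 : ℕ) = 2 ^ 9 := by norm_num
        rw [h512]
        exact Nat.mul_le_mul (Nat.mul_le_mul_left _ this) h2
    _ = 2 ^ (3 * N + 10) := by rw [← pow_mul, ← pow_add, ← pow_add]; congr 1; ring
    _ ≤ 2 ^ precP.eval N := Nat.pow_le_pow_right (by norm_num) (by have := (le_precP N).1; omega)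

/-- **`2ᵇ ≥ 4N² 9ᴺ N^{3N}`** (the permanent survives the rounding: `2n(n!)²(2N+1)^{2n}/2ᵇ ≤ n!/(2kε)`).
[folklore] -/
theorem two_pow_precP_ge' (N : ℕ) : 4 * N ^ 2 * 9 ^ N * N ^ (3 * N) ≤ 2 ^ precP.eval N := by
  have h1 : N ≤ 2 ^ N := Nat.lt_two_pow_self.le
  calc 4 * N ^ 2 * 9 ^ N * N ^ (3 * N) ≤ 2 ^ 2 * (2 ^ N) ^ 2 * 16 ^ N * (2 ^ N) ^ (3 * N) := by
        have h9 : 9 ^ N ≤ 16 ^ N := Nat.pow_le_pow_left (by norm_num) N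
        have hN2 := Nat.pow_le_pow_left h1 2
        have hN3 := Nat.pow_le_pow_left h1 (3 * N)
        have h4 : (4 : ℕ) = 2 ^ 2 := by norm_num
        rw [h4]
        exact Nat.mul_le_mul (Nat.mul_le_mul (Nat.mul_le_mul_left _ hN2) h9) hN3
    _ = 2 ^ (3 * N ^ 2 + 6 * N + 2) := by
        rw [show (16 : ℕ) = 2 ^ 4 by norm_num, ← pow_mul, ← pow_mul, ← pow_mul, ← pow_add, ← pow_add, ← pow_add]
        congr 1; ring
    _ ≤ 2 ^ precP.eval N := Nat.pow_le_pow_right (by norm_num) (by have := (le_precP N).1; omega)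

/-! ### The coin polynomial -/

section Coins

variable (p₀ cO cS : Polynomial ℕ)

/-- `queryLenB` as a polynomial in polynomial arguments. [folklore] -/
def queryLenPoly (nP MP bqP kβP : Polynomial ℕ) : Polynomial ℕ :=
  2 * (2 * nP + 2 * MP + 2 * bqP + 6 + (2 * MP + 2 + MP * (2 * (2 * nP + 2 + nP * (2 * (3 * (bqP + 5) + 2) + 2)) + 2))) + 2 + kβP

/-- `outcomeLenB` as a polynomial. [folklore] -/
def outcomeLenPoly (nP MP : Polynomial ℕ) : Polynomial ℕ := 2 * nP + 2 + nP * (2 * MP + 2)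

/-- Evaluation of `queryLenPoly`. [folklore] -/
theorem eval_queryLenPoly (nP MP bqP kβP : Polynomial ℕ) (N : ℕ) :
    (queryLenPoly nP MP bqP kβP).eval N = queryLenB (nP.eval N) (MP.eval N) (bqP.eval N) (kβP.eval N) := by
  simp [queryLenPoly, queryLenB, eval_add, eval_mul]

/-- Evaluation of `outcomeLenPoly`. [folklore] -/
theorem eval_outcomeLenPoly (nP MP : Polynomial ℕ) (N : ℕ) :
    (outcomeLenPoly nP MP).eval N = outcomeLenB (nP.eval N) (MP.eval N) := by
  simp [outcomeLenPoly, outcomeLenB, eval_add, eval_mul]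

/-- `queryLenB` is monotone. [folklore] -/
theorem queryLenB_mono {n n' M M' bq bq' kβ kβ' : ℕ} (hn : n ≤ n') (hM : M ≤ M') (hb : bq ≤ bq') (hk : kβ ≤ kβ') :
    queryLenB n M bq kβ ≤ queryLenB n' M' bq' kβ' := by
  unfold queryLenB
  gcongr

/-- `outcomeLenB` is monotone. [folklore] -/
theorem outcomeLenB_mono {n n' M M' : ℕ} (hn : n ≤ n') (hM : M ≤ M') : outcomeLenB n M ≤ outcomeLenB n' M' := by
  unfold outcomeLenB
  gcongr

/-- Polynomial bound of the number of modes `m`. [folklore] -/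
def modesP : Polynomial ℕ := 2 * hidH.mP + 1

/-- Polynomial bound of the sampler's attempt length `r₀ + b + 1 + Mmax · k`. [folklore] -/
def attP : Polynomial ℕ := (X + 4) + precP + 1 + hidH.mmaxBudget * (hidH.kP + 1)

/-- Polynomial bound of the sampler's coin length `L_c = J · attLen`. [folklore] -/
def coinLenP : Polynomial ℕ := hidH.JP * attP

/-- Polynomial bound of the query precision `b_q = p₀(m + kβ)`. [folklore] -/
def bqP : Polynomial ℕ := p₀.comp (modesP + hidH.kβP)

/-- Polynomial bound of the counter's coin demand `stockLenB`. [folklore] -/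
def stockP : Polynomial ℕ :=
  cS.comp (2 * queryLenPoly X modesP (bqP p₀) hidH.kβP + 2 + outcomeLenPoly X modesP +
    cO.comp (queryLenPoly X modesP (bqP p₀) hidH.kβP) + hidH.kηP + hidH.kδSP)

/-- **The coin polynomial**: positions `n μ`, sampler array `m · n · 2L_c`, counter `stockLenB`, and
slack `N + b`. [cite: AaronsonArkhipovToC2013, proof of Thm. 1.3 (p. 195)] -/
def coinP : Polynomial ℕ := X * hidH.mP + modesP * X * (2 * coinLenP) + stockP p₀ cO cS + X + precP

variable {p₀ cO cS}

/-- `μ ≤ mP(N)`. [folklore] -/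
theorem hidH_μ_le (N : ℕ) : hidH.μ N ≤ hidH.mP.eval N := by
  unfold HPolys.μ
  exact Nat.size_le.2 Nat.lt_two_pow_self

/-- `m ≤ modesP(N)`. [folklore] -/
theorem hidH_m_le_modesP (N : ℕ) : hidH.m N ≤ modesP.eval N := by
  have := (hidH_m_bounds N).2
  simp only [modesP, eval_add, eval_mul, eval_ofNat, eval_one, hidH_mP_eval]
  exact this

/-- `r₀ ≤ N + 4`. [folklore] -/
theorem r₀_le (N : ℕ) : HPolys.r₀ N ≤ N + 4 := by
  unfold HPolys.r₀
  have h1 : Nat.size (Nat.size N + 1) ≤ Nat.size N + 1 := Nat.size_le.2 Nat.lt_two_pow_self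
  have h2 : Nat.size N ≤ N := Nat.size_le.2 Nat.lt_two_pow_self
  omega

/-- `k ≤ kP(N) + 1`. [folklore] -/
theorem hidH_k_le (N : ℕ) : hidH.k N ≤ hidH.kP.eval N + 1 := by
  unfold HPolys.k
  exact (Nat.size_le.2 Nat.lt_two_pow_self).trans (Nat.le_succ _)

/-- **The sampler's coin length is at most `coinLenP(N)`** at precision `precP(N)`. [folklore] -/
theorem coinLen_le_coinLenP (N : ℕ) : (hidH.pg (precP.eval N) N).coinLen ≤ coinLenP.eval N := by
  simp only [HPolys.pg, PGParams.coinLen, PGParams.attLen, PGParams.hdrLen, PGParams.Mmax, coinLenP, attP, eval_mul, eval_add,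
    eval_X, eval_ofNat, eval_one, HPolys.J]
  refine Nat.mul_le_mul_left _ ?_
  have h1 := r₀_le N
  have h2 := hidH.mmax_le N
  have h3 := hidH_k_le N
  have h4 : 2 ^ (2 * HPolys.r₀ N + hidH.k N) * hidH.k N ≤ eval N hidH.mmaxBudget * (eval N hidH.kP + 1) := Nat.mul_le_mul h2 h3
  omega

/-- `b_q ≤ bqP(N)`. [folklore] -/
theorem bq_le_bqP (N : ℕ) : hidH.bq p₀ N ≤ (bqP p₀).eval N := by
  unfold HPolys.bq bqP
  rw [eval_comp, eval_add]
  exact TM2Iter.eval_mono _ (Nat.add_le_add_right (hidH_m_le_modesP N) _)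

/-- **The counter's coin demand is at most `stockP(N)`** (for `n ≤ N`). [folklore] -/
theorem stockLenB_le_stockP {n N : ℕ} (hn : n ≤ N) :
    stockLenB cO cS n (hidH.m N) (hidH.bq p₀ N) (hidH.kβ N) (hidH.kη N) (hidH.kδS N) ≤ (stockP p₀ cO cS).eval N := by
  unfold stockLenB stockP
  rw [eval_comp]
  refine TM2Iter.eval_mono _ ?_
  simp only [eval_add, eval_mul, eval_ofNat, eval_comp, eval_queryLenPoly, eval_outcomeLenPoly, eval_X]
  have hq : queryLenB n (hidH.m N) (hidH.bq p₀ N) (hidH.kβ N) ≤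
      queryLenB N (modesP.eval N) ((bqP p₀).eval N) (hidH.kβP.eval N) :=
    queryLenB_mono hn (hidH_m_le_modesP N) (bq_le_bqP N) le_rfl
  have ho : outcomeLenB n (hidH.m N) ≤ outcomeLenB N (modesP.eval N) := outcomeLenB_mono hn (hidH_m_le_modesP N)
  have hc : cO.eval (queryLenB n (hidH.m N) (hidH.bq p₀ N) (hidH.kβ N)) ≤
      cO.eval (queryLenB N (modesP.eval N) ((bqP p₀).eval N) (hidH.kβP.eval N)) := TM2Iter.eval_mono _ hq
  have hkη : hidH.kη N = hidH.kηP.eval N := rfl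
  have hkδ : hidH.kδS N = hidH.kδSP.eval N := rfl
  omega

/-- **The coin budget splits into the three fields**: with `LU := coinP(N) − (nμ + m n 2L_c)`,
`coinP(N) = nμ + m·n·2L_c + LU`, the counter's demand fits (`stockLenB ≤ LU`), and `N, b ≤ coinP(N)`.
[cite: AaronsonArkhipovToC2013, proof of Thm. 1.3 (p. 195)] -/
theorem coin_fields {n N : ℕ} (hn : n ≤ N) :
    n * hidH.μ N + hidH.m N * (n * (2 * (hidH.pg (precP.eval N) N).coinLen)) +
        ((coinP p₀ cO cS).eval N - (n * hidH.μ N + hidH.m N * (n * (2 * (hidH.pg (precP.eval N) N).coinLen)))) =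
      (coinP p₀ cO cS).eval N ∧
    stockLenB cO cS n (hidH.m N) (hidH.bq p₀ N) (hidH.kβ N) (hidH.kη N) (hidH.kδS N) ≤
      (coinP p₀ cO cS).eval N - (n * hidH.μ N + hidH.m N * (n * (2 * (hidH.pg (precP.eval N) N).coinLen))) ∧
    N ≤ (coinP p₀ cO cS).eval N ∧ precP.eval N ≤ (coinP p₀ cO cS).eval N := by
  have h1 : n * hidH.μ N ≤ N * hidH.mP.eval N := Nat.mul_le_mul hn (hidH_μ_le N)
  have h2 : hidH.m N * (n * (2 * (hidH.pg (precP.eval N) N).coinLen)) ≤ modesP.eval N * N * (2 * coinLenP.eval N) := by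
    rw [mul_assoc]
    exact Nat.mul_le_mul (hidH_m_le_modesP N) (Nat.mul_le_mul hn (Nat.mul_le_mul_left _ (coinLen_le_coinLenP N)))
  have h3 := stockLenB_le_stockP (p₀ := p₀) (cO := cO) (cS := cS) hn
  have hC : (coinP p₀ cO cS).eval N = N * hidH.mP.eval N + modesP.eval N * N * (2 * coinLenP.eval N) +
      (stockP p₀ cO cS).eval N + N + precP.eval N := by
    simp only [coinP, eval_add, eval_mul, eval_X, eval_ofNat]
  refine ⟨?_, ?_, ?_, ?_⟩ <;> omega

end Coins

/-! ### The dimension and the extra modes -/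

/-- With `e := m − n` one has `m = n + e` (`n ≤ N ≤ m`). [folklore] -/
theorem hidH_m_eq {n N : ℕ} (hn : n ≤ N) : hidH.m N = n + (hidH.m N - n) := by
  have := (le_hidH_m N).1
  omega

/-- `3n² ≤ n + e`. [folklore] -/
theorem three_mul_sq_le {n N : ℕ} (hn : n ≤ N) : 3 * n ^ 2 ≤ n + (hidH.m N - n) := by
  rw [← hidH_m_eq hn]
  have := (le_hidH_m N).2.1
  have : n ^ 2 ≤ N ^ 2 := Nat.pow_le_pow_left hn 2
  omega

end Literature.Computability.QuantumComplexity
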